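import Literature.MathematicalPhysics.QuantumFieldTheory.Balaban1983to89.B3Eq116TwoSidedExpansion
import Literature.MathematicalPhysics.QuantumFieldTheory.Balaban1983to89.B2Ineq329CovariantAveraging

/-!
# `Balaban1983to89.B3Op116Pieces` — T. Bałaban, *(Higgs)₂,₃ quantum fields in a finite volume. III. Renormalization*,
Commun. Math. Phys. **88** (1983) 411–445 [Balaban1983Higgs3], p. 414 (1.16), with [Balaban1982Higgs1] (= I) pp. 614–615,
619: the operator `V_k(Ã,B̃)` of (1.16)/(I.3.44) — `B3Eq116TwoSidedExpansion.opV` = `H_k(Ω,B̃) − H_k(Ω,Ã+B̃)` on the carriers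
of record `…HiggsCovariance` — DECOMPOSED as print's square bracket of (I.3.44) via (I.3.14), (I.3.15), (I.3.16): the bondwise
split of the covariant derivative, the split of the averaging operator `Q_k(Ã+B̃) = Q_k(B̃) + F_{2,k}(Ã,B̃)`, the WEAK FORM of
`V_k` for the scalar products (I.1.5), and the SIZES of the pieces under `sup_b |Ã_b| ≤ s` (`|e|·s` per bond multiplier,
`|e|·s·ε·d(L^k − 1)` per averaging difference)

statement-level skeleton of published theorems with citation tags; proofs where landed; nothing here is a claim about the Yang–Mills mass gap

PDF held: `paper:balaban1983-higgs-2-3-quantum-fields-finite-volume` (journal page = PDF page + 410), p. 414 [PDF 4] `p0004.txt`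
L19–33; `paper:balaban1982-cmp85-higgs23-i` (journal page = PDF page + 602), pp. 614–615 [PDF 12–13] (3.14)–(3.16), p. 619
[PDF 17] (3.44) (text layer; the displays as quoted in the tree's `…Balaban1983to89.B1` module docstring, ll. 300–330).

CITATION HEADER (lean-in-tree rule).  lit-balaban TYPED SKELETON (HOME `run/shared/lean/pub/lit-balaban/`), Phase 2, proof seat
p40 (gen 70, literature-prover-lit-balaban-p40-g70-0): FILE 2 `B3Op116Pieces` of r14 g19's programme on the ANALYTIC half of
SKELETON row **B3.Eq1.16** (HOME/STATUS 2026-08-23T00:45:37Z; written and filed by p40 on r14's word 00:50:46Z, to r14's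
spec; FILE 1 = p40's `B3Eq116TwoSidedExpansion`, the identity half; FILES 3–4 = r14's kernel bounds of (1.16) consuming
this file BY NAME).  Rows touched: B3.Eq1.16 (owner r15; located member, NO head claim), B1.Eq3.14 / B1.Eq3.15 / B1.Eq3.16
(owners r01/r12/r14; heads `proved`/`proved-existing` by `B1Eq314Proof` / `B1.display315` / `B1.display316` — this file gives
the same identities ON THE CARRIERS OF RECORD, located members).

THE PRINTED FORMULAS (quoted from the tree's transcription in `…Balaban1983to89.B1`, ll. 300–330, themselves read on the
renders).  (I.3.14) p. 614: *"U(A) = exp(ηqe(L^kε)A) = 1 + … =: 1 + ηF_{1,k}(A) =: 1 + F′_{1,k}(A)"*; [Balaban1983RegularityDecay]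
p. 580: *"F_{1,k}(A) = η^{−1}(U(A) − 1)"*, *"D^η_A = U(A′)D^η_{A₀} + F_{1,k}(A′)"*.  (I.3.15) p. 614: *"(Q_k(A+B)φ)(y) =
L^{−kd} Σ_{x∈B^k(y)} U((A+B)(Γ^{(k)}_{y,x}))φ(x) = (Q_k(B)φ)(y) + L^{−kd} Σ_{x∈B^k(y)} F′_{1,k}(A(Γ^{(k)}_{y,x}))U(B(Γ^{(k)}_{y,x}))φ(x)
=: (Q_k(B)φ)(y) + (F_{2,k}(A,B)φ)(y)"*.  (I.3.16) p. 615: *"−Δ^{η,N}_{A+B,Ω} + a_kP_k(A+B) = −Δ^{η,N}_{B,Ω} − F_{1,k}(−A)^*D^η_B −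
D^{η*}_B F_{1,k}(−A) + F_{1,k}(−A)^*F_{1,k}(−A) + a_kP_k(B) + a_kF_{2,k}(A,B)^*Q_k(B) + a_kQ_k^*(B)F_{2,k}(A,B) +
a_kF_{2,k}(A,B)^*F_{2,k}(A,B)"*.  (I.3.44) p. 619 / p. 620: *"Let us denote the operator in the square bracket in (3.44) by
V_k"*, the bracket being `F_{1,k}(−A)^*D^η_B + D^{η*}_B F_{1,k}(−A) − F_{1,k}(−A)^*F_{1,k}(−A) − a_kF_{2,k}(A,B)^*Q_k(B) −
a_kQ_k^*(B)F_{2,k}(A,B) − a_kF_{2,k}(A,B)^*F_{2,k}(A,B)`.  [Balaban1983Higgs3] p. 414: *"[G_k(Ω,B̃)V_k(Ã,B̃)]^n G_k(Ω,Ã+B̃)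
[V_k(Ã,B̃)G_k(Ω,B̃)]^{n′}, (1.16)"*.  (In this file `A` ↤ Ã is the FIRST field argument, `B` ↤ B̃ the second, as in FILE 1.)

WHAT THIS MODULE PROVES (sorry-free; `def`s WITH BODIES `fOne`, `mulM`, `fTwo`, `fTwoAdj`; no `Prop` fact introduced).
§1 THE BOND MULTIPLIER (I.3.14).  `fOne C η a := η⁻¹ • (U(η,a) − 1)` = `F_{1,k}(a)`; `mulM C A B b := ε⁻¹ • U(ε,B_b)(U(ε,A_b) − 1)`,
the ADDITIVE multiplier: **`covDeriv_add_split`** `(D^ε_{A+B}φ)(b) = (D^ε_Bφ)(b) + M_b φ(b₊)`; the printed shape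
**`covDeriv_add_eq_U_comp_add_fOne`** `(D^ε_{A+B}φ)(b) = U(ε,A_b)(D^ε_Bφ)(b) + F_{1,k}(A_b)φ(b₋)` ([B4] p. 580 *"D^η_A =
U(A′)D^η_{A₀} + F_{1,k}(A′)"*); the dictionary `mulM_apply_tgt` between the two; `star_U_comp_fOne` (`U(a)^*F_{1,k}(a) =
−F_{1,k}(−a)`, the hypothesis `hwf` of `B1.display316`); SIZES `norm_fOne_le` (`‖F_{1,k}(a)‖ ≤ |e|·|a|`), `norm_mulM_le`
(`‖M_b‖ ≤ |e|·|A_b|`), `norm_mulM_apply_le` (`‖M_b v‖ ≤ |e|·s·‖v‖` when `|A_b| ≤ s`) — from the tree's sharp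
`B2Ineq329CovariantAveraging.norm_U_sub_one_le` (`‖U(η,a) − 1‖ ≤ |ηea|`, mean-value inequality) and unitarity.
§2 THE AVERAGING DIFFERENCE (I.3.15).  `fTwo C A B k := avgQkLin C (A+B) k − avgQkLin C B k` = `F_{2,k}(A,B)` and its adjoint
twin `fTwoAdj := avgQkAdj C (A+B) k − avgQkAdj C B k`; **`fTwo_apply`** = the printed formula
`(F_{2,k}(A,B)φ)(y) = L^{−kd} Σ_{x∈B^k(y)} (U(A(Γ^{(k)}_{y,x})) − 1)U(B(Γ^{(k)}_{y,x}))φ(x)` (from `HiggsAveraging.holQk_add` =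
`U((A+B)(Γ)) = U(A(Γ))U(B(Γ))`); `avgQkLin_add` ((I.3.15) as the operator identity `Q_k(A+B) = Q_k(B) + F_{2,k}(A,B)`);
`siteInner_fTwo` (adjointness of the twin); SIZES `norm_fTwo_apply_le` (`‖(F_{2,k}φ)(y)‖ ≤ |e|·s·ε·d(L^k−1)·L^{−kd}Σ_{x∈B^k(y)}‖φ(x)‖`
for `sup_b|A_b| ≤ s`, `k ≤ K`; contour length `B2Ineq329PrismHolonomy.sum_steps_le`), `norm_fTwoAdj_apply_le`, and the `ℓ²`
corollary `siteInner_fTwo_self_le` (`‖F_{2,k}φ‖²_{T^{(k)}} ≤ (|e|sεd(L^k−1))²‖φ‖²_{T_ε}`, Cauchy–Schwarz over the blocks,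
`B1Eq353SupNorm.card_blockK`) and its adjoint twin `siteInner_fTwoAdj_self_le`.
§3 THE WEAK FORM OF `V_k` ((I.3.16) for the scalar products (I.1.5)).  **`siteInner_opV`**:
`⟨ψ, V_k(A,B)φ⟩_{T_ε} = −Σ_{b⊂Ω} ε^d[⟪M_bψ(b₊), (D^ε_Bφ)(b)⟫ + ⟪(D^ε_Bψ)(b), M_bφ(b₊)⟫ + ⟪M_bψ(b₊), M_bφ(b₊)⟫]
− a_k(L^kε)^{−2}[⟨F₂ψ, Q_k(B)φ⟩_{T^{(k)}} + ⟨Q_k(B)ψ, F₂φ⟩_{T^{(k)}} + ⟨F₂ψ, F₂φ⟩_{T^{(k)}}]` (Neumann: only the bonds with both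
ends in `Ω`, `HiggsCovariancePos.Inside`), from `HiggsCovariancePos.siteInner_covLaplacianN` (`−Δ^{ε,N}_{X,Ω}` IS the Dirichlet
form on the inside bonds) and `siteInner_avgQkLin` (`Q_k^*` IS the adjoint); and the PRINTED-BRACKET weak form
**`siteInner_opV_printed`**: the same with the three bond terms rewritten as
`+⟪F_{1,k}(−A_b)ψ(b₋), (D^ε_Bφ)(b)⟫ + ⟪(D^ε_Bψ)(b), F_{1,k}(−A_b)φ(b₋)⟫ − ⟪F_{1,k}(−A_b)ψ(b₋), F_{1,k}(−A_b)φ(b₋)⟫` — i.e.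
`⟨ψ, V_kφ⟩ = ⟨ψ, [F_{1,k}(−A)^*D^ε_B + D^{ε*}_BF_{1,k}(−A) − F_{1,k}(−A)^*F_{1,k}(−A) − a_k(F₂^*Q_k(B) + Q_k^*(B)F₂ + F₂^*F₂)]φ⟩`
read as forms: `opV` IS print's square bracket of (I.3.44) on these carriers (the bond identity `bracket_bond_identity` is
exactly the content of (I.3.16)'s first line: unitarity of `U(A_b)` and `U(A_b)^*F_{1,k}(A_b) = −F_{1,k}(−A_b)`).
§4 `ℓ²` SIZE OF THE BOND PART: `sum_inside_norm_mulM_sq_le` (`Σ_{b⊂Ω} ε^d‖M_bψ(b₊)‖² ≤ (|e|s)²·d·‖ψ‖²_{T_ε}`).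

HONEST SCOPE.  (a) Identities and sizes of the PIECES only: nothing here bounds the kernel of (1.16) — that is r14's FILES 3–4
(p. 414: *"for n, n′ sufficiently large, a kernel of the operator (1.16) is a sufficiently regular function of both variables …
uniformly bounded by O(1)(e(L^kε)^{1−α})^{n+n′}"* — NOT proved here, nor in FILE 1).  (b) The smallness hypothesis is
`|A_b| ≤ s` on ALL bonds of `T_ε` (simplest; print's Ã = A′^{(k)} is defined on the whole lattice); regularity of `A` is not
used here.  (c) `U` is the one-parameter group `exp(εeA·q)` of the carriers (`‖q‖ ≤ 1`, `q^* = −q`): all transports commute —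
this is the (Higgs)₂,₃ model's structure, not an abelian simplification of ours.  (d) The operator form of (I.3.16) with the six
adjoints as named linear maps is not spelled out; the weak form over the non-degenerate scalar products (I.1.5) is its content
(`HiggsCovariancePos.eq_zero_of_siteInner_self_eq_zero`).  (e) `k ≤ K` (the number of levels of the torus family) is needed
only for the contour-length count `d(L^k − 1)`.
-/

namespace Literature.MathematicalPhysics.QuantumFieldTheory.Balaban1983to89.B3Op116Pieces

open scoped BigOperators InnerProductSpace
open Literature.MathematicalPhysics.QuantumFieldTheory.Balaban1983to89.HiggsLattice
open Literature.MathematicalPhysics.QuantumFieldTheory.Balaban1983to89.HiggsAveraging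
open Literature.MathematicalPhysics.QuantumFieldTheory.Balaban1983to89.HiggsCovariance
open Literature.MathematicalPhysics.QuantumFieldTheory.Balaban1983to89.HiggsCovariancePos
open Literature.MathematicalPhysics.QuantumFieldTheory.Balaban1983to89.B2Ineq329PrismHolonomy
open Literature.MathematicalPhysics.QuantumFieldTheory.Balaban1983to89.B2Ineq329CovariantAveraging
open Literature.MathematicalPhysics.QuantumFieldTheory.Balaban1983to89.B3Eq116TwoSidedExpansion

variable {P : Params} {N : ℕ}

/-! ## §1. The bond multiplier: (I.3.14) and the split of the covariant derivative -/

section Bond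

/-- **`F_{1,k}(a) = η⁻¹(U(η,a) − 1)`** ((I.3.14) p. 614: `U(A) = 1 + ηF_{1,k}(A)`; [Balaban1983RegularityDecay] p. 580:
*"F_{1,k}(A) = η^{−1}(U(A) − 1)"*), as an operator of `ℝ^N`. [cite: Balaban1982Higgs1, (3.14) p.614] -/
noncomputable def fOne (C : ChargeData N) (η a : ℝ) : E N →L[ℝ] E N :=
  η⁻¹ • (C.U η a - 1)

/-- `F_{1,k}(a)v = η⁻¹(U(η,a)v − v)`. [cite: Balaban1982Higgs1, (3.14) p.614] -/
theorem fOne_apply (C : ChargeData N) (η a : ℝ) (v : E N) : fOne C η a v = η⁻¹ • (C.U η a v - v) := by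
  simp only [fOne, smul_apply, sub_apply, one_apply_eq_self]

/-- (I.3.14): `U(η,a)v = v + η·F_{1,k}(a)v` (`η ≠ 0`). [cite: Balaban1982Higgs1, (3.14) p.614] -/
theorem U_apply_eq_add_smul_fOne (C : ChargeData N) {η : ℝ} (hη : η ≠ 0) (a : ℝ) (v : E N) :
    C.U η a v = v + η • fOne C η a v := by
  rw [fOne_apply, smul_smul, mul_inv_cancel₀ hη, one_smul, add_sub_cancel]

/-- The transports of the model commute: `U(η,a)U(η,b) = U(η,b)U(η,a)` (both `= U(η,a+b)`, p. 605). [cite: Balaban1982Higgs1, (1.7) p.605] -/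
theorem U_comm (C : ChargeData N) (η a b : ℝ) : C.U η a * C.U η b = C.U η b * C.U η a := by
  rw [← ChargeData.U_add, add_comm, ChargeData.U_add]

/-- `U(η,−a)(U(η,a)v) = v`. [cite: Balaban1982Higgs1, (1.7) p.605] -/
theorem U_neg_apply_U_apply (C : ChargeData N) (η a : ℝ) (v : E N) : C.U η (-a) (C.U η a v) = v := by
  rw [← mul_apply_eq_comp, U_comm, ChargeData.U_mul_U_neg, one_apply_eq_self]

/-- `U(η,a)(U(η,−a)v) = v`. [cite: Balaban1982Higgs1, (1.7) p.605] -/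
theorem U_apply_U_neg_apply (C : ChargeData N) (η a : ℝ) (v : E N) : C.U η a (C.U η (-a) v) = v := by
  rw [← mul_apply_eq_comp, ChargeData.U_mul_U_neg, one_apply_eq_self]

/-- The transports preserve norms (unitarity, p. 605). [cite: Balaban1982Higgs1, (1.7) p.605] -/
theorem norm_U_apply (C : ChargeData N) (η a : ℝ) (v : E N) : ‖C.U η a v‖ = ‖v‖ :=
  ContinuousLinearMap.norm_map_of_mem_unitary (C.U_mem_unitary η a) v

/-- **`U(a)^* F_{1,k}(a) = −F_{1,k}(−a)`** applied to a vector (`U^* = U(−a)`, `U(−a)(U(a)v − v) = v − U(−a)v`): the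
hypothesis `hwf` of the tree's abstract (I.3.16) `B1.display316`. [cite: Balaban1982Higgs1, (3.16) p.615] -/
theorem star_U_apply_fOne (C : ChargeData N) (η a : ℝ) (v : E N) :
    star (C.U η a) (fOne C η a v) = -(fOne C η (-a) v) := by
  rw [ChargeData.star_U, fOne_apply, fOne_apply, map_smul, map_sub, U_neg_apply_U_apply, ← smul_neg, neg_sub]

/-- `F_{1,k}(a)w = −U(a)(F_{1,k}(−a)w)`. [cite: Balaban1982Higgs1, (3.14) p.614] -/
theorem fOne_apply_eq_neg_U (C : ChargeData N) (η a : ℝ) (w : E N) :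
    fOne C η a w = -(C.U η a (fOne C η (-a) w)) := by
  rw [fOne_apply, fOne_apply, map_smul, map_sub, U_apply_U_neg_apply, ← smul_neg, neg_sub]

/-- **`‖F_{1,k}(a)‖ ≤ |e|·|a|`** (`‖U(η,a) − 1‖ ≤ |ηea|`, the tree's `norm_U_sub_one_le`; `η ≠ 0`). [cite: Balaban1982Higgs1, (3.14) p.614] -/
theorem norm_fOne_le (C : ChargeData N) {η : ℝ} (hη : η ≠ 0) (a : ℝ) : ‖fOne C η a‖ ≤ |C.e| * |a| := by
  rw [fOne, norm_smul, norm_inv, Real.norm_eq_abs]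
  calc |η|⁻¹ * ‖C.U η a - 1‖ ≤ |η|⁻¹ * |η * C.e * a| :=
        mul_le_mul_of_nonneg_left (norm_U_sub_one_le C η a) (inv_nonneg.mpr (abs_nonneg η))
    _ = |C.e| * |a| := by
        rw [abs_mul, abs_mul, ← mul_assoc, ← mul_assoc, inv_mul_cancel₀ (abs_ne_zero.mpr hη), one_mul]

/-- `‖F_{1,k}(a)v‖ ≤ |e|·|a|·‖v‖`. [cite: Balaban1982Higgs1, (3.14) p.614] -/
theorem norm_fOne_apply_le (C : ChargeData N) {η : ℝ} (hη : η ≠ 0) (a : ℝ) (v : E N) :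
    ‖fOne C η a v‖ ≤ |C.e| * |a| * ‖v‖ :=
  (ContinuousLinearMap.le_opNorm _ _).trans (mul_le_mul_of_nonneg_right (norm_fOne_le C hη a) (norm_nonneg _))

variable (C : ChargeData N) (A B : VecField P 0)

/-- **THE ADDITIVE BOND MULTIPLIER `M_b`** of the split `D^ε_{A+B} = D^ε_B + M`:
`M_b = ε⁻¹ U(ε,B_b)(U(ε,A_b) − 1)` acting on the value `φ(b₊)` (`= U(ε,B_b)F_{1,k}(A_b)`). [cite: Balaban1982Higgs1, (3.14) p.614] -/
noncomputable def mulM (b : PBond P 0) : E N →L[ℝ] E N :=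
  (P.mesh 0)⁻¹ • (C.U (P.mesh 0) (B b) * (C.U (P.mesh 0) (A b) - 1))

/-- `M_b v = U(ε,B_b)(F_{1,k}(A_b)v)`. [cite: Balaban1982Higgs1, (3.14) p.614] -/
theorem mulM_apply (b : PBond P 0) (v : E N) :
    mulM C A B b v = C.U (P.mesh 0) (B b) (fOne C (P.mesh 0) (A b) v) := by
  simp only [mulM, fOne_apply, smul_apply, mul_apply_eq_comp, sub_apply, one_apply_eq_self, map_smul]

/-- **THE SPLIT OF THE COVARIANT DERIVATIVE**: `(D^ε_{A+B}φ)(b) = (D^ε_Bφ)(b) + M_bφ(b₊)` (from `U(A_b + B_b) = U(B_b)U(A_b)`,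
p. 605). [cite: Balaban1982Higgs1, (3.14) p.614] -/
theorem covDeriv_add_split (φ : ScalarField P 0 N) (b : PBond P 0) :
    covDeriv C (A + B) φ b = covDeriv C B φ b + mulM C A B b (φ b.tgt) := by
  rw [mulM_apply, fOne_apply, map_smul, map_sub]
  simp only [covDeriv, Pi.add_apply]
  rw [add_comm (A b) (B b), ChargeData.U_add, mul_apply_eq_comp, ← smul_add]
  congr 1
  abel

/-- **(I.3.14) IN THE PRINTED SHAPE** ([Balaban1983RegularityDecay] p. 580: *"D^η_A = U(A′)D^η_{A₀} + F_{1,k}(A′)"*, A = A₀ + A′):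
`(D^ε_{A+B}φ)(b) = U(ε,A_b)(D^ε_Bφ)(b) + F_{1,k}(A_b)φ(b₋)` — the hypothesis `hD` of `B1.display316`. [cite: Balaban1982Higgs1, (3.14) p.614] -/
theorem covDeriv_add_eq_U_apply_add_fOne (φ : ScalarField P 0 N) (b : PBond P 0) :
    covDeriv C (A + B) φ b = C.U (P.mesh 0) (A b) (covDeriv C B φ b) + fOne C (P.mesh 0) (A b) (φ b.src) := by
  rw [fOne_apply]
  simp only [covDeriv, Pi.add_apply]
  rw [ChargeData.U_add, mul_apply_eq_comp, map_smul, map_sub, ← smul_add]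
  congr 1
  abel

/-- The dictionary between the two shapes: `M_bφ(b₊) = (U(ε,A_b)(D^ε_Bφ)(b) − (D^ε_Bφ)(b)) + F_{1,k}(A_b)φ(b₋)`. [cite: Balaban1982Higgs1, (3.14) p.614] -/
theorem mulM_apply_tgt (φ : ScalarField P 0 N) (b : PBond P 0) :
    mulM C A B b (φ b.tgt)
      = (C.U (P.mesh 0) (A b) (covDeriv C B φ b) - covDeriv C B φ b) + fOne C (P.mesh 0) (A b) (φ b.src) := by
  have h1 := covDeriv_add_split C A B φ b
  have h2 := covDeriv_add_eq_U_apply_add_fOne C A B φ b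
  rw [h1] at h2
  have h3 : mulM C A B b (φ b.tgt)
      = C.U (P.mesh 0) (A b) (covDeriv C B φ b) + fOne C (P.mesh 0) (A b) (φ b.src) - covDeriv C B φ b :=
    eq_sub_of_add_eq' h2
  rw [h3]
  abel

/-- `‖M_b v‖ ≤ |e|·|A_b|·‖v‖` (unitarity of `U(ε,B_b)` and `‖F_{1,k}(A_b)‖ ≤ |e||A_b|`). [cite: Balaban1982Higgs1, (3.14) p.614] -/
theorem norm_mulM_apply_le' (b : PBond P 0) (v : E N) : ‖mulM C A B b v‖ ≤ |C.e| * |A b| * ‖v‖ := by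
  rw [mulM_apply, norm_U_apply]
  exact norm_fOne_apply_le C (P.mesh_pos 0).ne' (A b) v

/-- **`‖M_b v‖ ≤ |e|·s·‖v‖`** when `|A_b| ≤ s` (the per-bond size used by FILE 3). [cite: Balaban1982Higgs1, (3.14) p.614] -/
theorem norm_mulM_apply_le {s : ℝ} {b : PBond P 0} (hA : |A b| ≤ s) (v : E N) :
    ‖mulM C A B b v‖ ≤ |C.e| * s * ‖v‖ :=
  (norm_mulM_apply_le' C A B b v).trans (by gcongr)

/-- `‖M_b‖ ≤ |e|·|A_b|` (operator norm). [cite: Balaban1982Higgs1, (3.14) p.614] -/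
theorem norm_mulM_le (b : PBond P 0) : ‖mulM C A B b‖ ≤ |C.e| * |A b| :=
  ContinuousLinearMap.opNorm_le_bound _ (mul_nonneg (abs_nonneg _) (abs_nonneg _)) (norm_mulM_apply_le' C A B b)

/-- **THE BOND IDENTITY OF (I.3.16)**: for one bond with transport `U = U(η,a)`, `F = F_{1,k}(a)`, `Fm = F_{1,k}(−a)`:
`⟪UX + Fu, UY + Fv⟫ − ⟪X, Y⟫ = −⟪Fm u, Y⟫ − ⟪X, Fm v⟫ + ⟪Fm u, Fm v⟫` (`X, Y` ↤ `(D^ε_Bψ)(b), (D^ε_Bφ)(b)`, `u, v` ↤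
`ψ(b₋), φ(b₋)`) — unitarity of `U` and `U^*F = −Fm`: the first line of (I.3.16),
`D^*_{A+B}D_{A+B} = D^*_BD_B − Fm^*D_B − D^*_BFm + Fm^*Fm`, bond by bond. [cite: Balaban1982Higgs1, (3.16) p.615] -/
theorem bracket_bond_identity (η a : ℝ) (X Y u v : E N) :
    ⟪C.U η a X + fOne C η a u, C.U η a Y + fOne C η a v⟫_ℝ - ⟪X, Y⟫_ℝ
      = -⟪fOne C η (-a) u, Y⟫_ℝ - ⟪X, fOne C η (-a) v⟫_ℝ + ⟪fOne C η (-a) u, fOne C η (-a) v⟫_ℝ := by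
  have hu : C.U η a X + fOne C η a u = C.U η a (X - fOne C η (-a) u) := by
    rw [fOne_apply_eq_neg_U C η a u, map_sub]; abel
  have hv : C.U η a Y + fOne C η a v = C.U η a (Y - fOne C η (-a) v) := by
    rw [fOne_apply_eq_neg_U C η a v, map_sub]; abel
  rw [hu, hv, inner_U_U]
  simp only [inner_sub_left, inner_sub_right]
  ring

end Bond

/-! ## §2. The averaging difference `F_{2,k}(A,B) = Q_k(A+B) − Q_k(B)` — (I.3.15) -/

section Averaging

variable (C : ChargeData N) (A B : VecField P 0) (k : ℕ)

/-- **`F_{2,k}(A,B) := Q_k(A+B) − Q_k(B)`** as a linear map `(T_ε → ℝ^N) → (T^{(k)} → ℝ^N)` ((I.3.15) p. 614; `Q_k` = the tree's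
`HiggsCovariance.avgQkLin`). [cite: Balaban1982Higgs1, (3.15) p.614] -/
noncomputable def fTwo : ScalarField P 0 N →ₗ[ℝ] ScalarField P k N :=
  avgQkLin C (A + B) k - avgQkLin C B k

/-- The adjoint twin `F_{2,k}(A,B)^* := Q_k^*(A+B) − Q_k^*(B)` (`Q_k^*` = `HiggsCovariance.avgQkAdj`). [cite: Balaban1982Higgs1, (3.16) p.615] -/
noncomputable def fTwoAdj : ScalarField P k N →ₗ[ℝ] ScalarField P 0 N :=
  avgQkAdj C (A + B) k - avgQkAdj C B k

/-- **(I.3.15) as the operator identity** `Q_k(A+B) = Q_k(B) + F_{2,k}(A,B)`. [cite: Balaban1982Higgs1, (3.15) p.614] -/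
theorem avgQkLin_add : avgQkLin C (A + B) k = avgQkLin C B k + fTwo C A B k := by
  rw [fTwo, add_sub_cancel]

/-- The adjoint form `Q_k^*(A+B) = Q_k^*(B) + F_{2,k}(A,B)^*`. [cite: Balaban1982Higgs1, (3.16) p.615] -/
theorem avgQkAdj_add : avgQkAdj C (A + B) k = avgQkAdj C B k + fTwoAdj C A B k := by
  rw [fTwoAdj, add_sub_cancel]

/-- **(I.3.15), THE PRINTED FORMULA FOR `F_{2,k}`**: `(F_{2,k}(A,B)φ)(y) = L^{−kd} Σ_{x∈B^k(y)} F′_{1,k}(A(Γ^{(k)}_{y,x}))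
U(B(Γ^{(k)}_{y,x}))φ(x)`, `F′_{1,k} = U − 1` — from `U((A+B)(Γ)) = U(A(Γ))U(B(Γ))` (`HiggsAveraging.multiContourSum_add`,
`ChargeData.U_add`; the tree's abstract `B1.display315` is this computation). [cite: Balaban1982Higgs1, (3.15) p.614] -/
theorem fTwo_apply (φ : ScalarField P 0 N) (y : Site P k) :
    fTwo C A B k φ y = (((P.L : ℝ) ^ (k * P.d))⁻¹) •
      ∑ x ∈ blockK k y, (C.U (P.mesh 0) (multiContourSum A k x) (C.U (P.mesh 0) (multiContourSum B k x) (φ x))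
        - C.U (P.mesh 0) (multiContourSum B k x) (φ x)) := by
  rw [fTwo, LinearMap.sub_apply, Pi.sub_apply, avgQkLin_apply, avgQkLin_apply, avgQk_apply, avgQk_apply, ← smul_sub,
    ← Finset.sum_sub_distrib]
  congr 1
  refine Finset.sum_congr rfl fun x _ => ?_
  rw [multiContourSum_add, ChargeData.U_add, mul_apply_eq_comp]

/-- `F_{2,k}(A,B)^*` IS the adjoint of `F_{2,k}(A,B)` for the scalar products (I.1.5) of the two lattices
(`HiggsCovariancePos.siteInner_avgQkLin`). [cite: Balaban1982Higgs1, (3.16) p.615] -/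
theorem siteInner_fTwo (φ : ScalarField P 0 N) (ψ : ScalarField P k N) :
    siteInner (fTwo C A B k φ) ψ = siteInner φ (fTwoAdj C A B k ψ) := by
  have hl : ∀ f g (h : ScalarField P k N), siteInner (f - g) h = siteInner f h - siteInner g h := fun f g h => by
    simp only [siteInner, Pi.sub_apply, inner_sub_left, mul_sub, Finset.sum_sub_distrib]
  have hr : ∀ (f : ScalarField P 0 N) g h, siteInner f (g - h) = siteInner f g - siteInner f h := fun f g h => by
    simp only [siteInner, Pi.sub_apply, inner_sub_right, mul_sub, Finset.sum_sub_distrib]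
  simp only [fTwo, fTwoAdj, LinearMap.sub_apply, hl, hr, siteInner_avgQkLin]

/-- The transports along the composite contours: `‖U(A(Γ^{(k)}_{y,x})) − 1‖ ≤ |e|·s·ε·d(L^k − 1)` when `|A_b| ≤ s` on all
bonds (`‖U(ε,a) − 1‖ ≤ |εea|` and the length `≤ d(L^k−1)` of `Γ^{(k)}_{y,x}`, `B2Ineq329PrismHolonomy.sum_steps_le`;
`k ≤ K`). [cite: Balaban1982Higgs1, (2.2) p.608] -/
theorem norm_U_multiContour_sub_one_le (hk : k ≤ P.K) {s : ℝ} (hs : 0 ≤ s) (hA : ∀ b : PBond P 0, |A b| ≤ s)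
    (x : Site P 0) :
    ‖C.U (P.mesh 0) (multiContourSum A k x) - 1‖ ≤ |C.e| * s * P.mesh 0 * (P.d * ((P.L : ℝ) ^ k - 1)) := by
  have hlen := abs_multiContourSum_le A k x (β := s) (fun i _ ν t _ => hA _)
  have hsteps := sum_steps_le hk x
  have hε : 0 < P.mesh 0 := P.mesh_pos 0
  calc ‖C.U (P.mesh 0) (multiContourSum A k x) - 1‖ ≤ |P.mesh 0 * C.e * multiContourSum A k x| :=
        norm_U_sub_one_le C _ _
    _ = P.mesh 0 * |C.e| * |multiContourSum A k x| := by rw [abs_mul, abs_mul, abs_of_pos hε]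
    _ ≤ P.mesh 0 * |C.e| * ((P.d * ((P.L : ℝ) ^ k - 1)) * s) := by
        refine mul_le_mul_of_nonneg_left (hlen.trans ?_) (mul_nonneg hε.le (abs_nonneg _))
        exact mul_le_mul_of_nonneg_right hsteps hs
    _ = |C.e| * s * P.mesh 0 * (P.d * ((P.L : ℝ) ^ k - 1)) := by ring

/-- The per-term size in (I.3.15): `‖U(A(Γ))(U(B(Γ))w) − U(B(Γ))w‖ ≤ |e|·s·ε·d(L^k−1)·‖w‖`. [cite: Balaban1982Higgs1, (3.15) p.614] -/
theorem norm_fTwo_term_le (hk : k ≤ P.K) {s : ℝ} (hs : 0 ≤ s) (hA : ∀ b : PBond P 0, |A b| ≤ s)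
    (x : Site P 0) (w : E N) :
    ‖C.U (P.mesh 0) (multiContourSum A k x) (C.U (P.mesh 0) (multiContourSum B k x) w)
        - C.U (P.mesh 0) (multiContourSum B k x) w‖
      ≤ |C.e| * s * P.mesh 0 * (P.d * ((P.L : ℝ) ^ k - 1)) * ‖w‖ := by
  have e : C.U (P.mesh 0) (multiContourSum A k x) (C.U (P.mesh 0) (multiContourSum B k x) w)
        - C.U (P.mesh 0) (multiContourSum B k x) w
      = (C.U (P.mesh 0) (multiContourSum A k x) - 1) (C.U (P.mesh 0) (multiContourSum B k x) w) := by
    rw [sub_apply, one_apply_eq_self]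
  rw [e]
  calc ‖(C.U (P.mesh 0) (multiContourSum A k x) - 1) (C.U (P.mesh 0) (multiContourSum B k x) w)‖
      ≤ ‖C.U (P.mesh 0) (multiContourSum A k x) - 1‖ * ‖C.U (P.mesh 0) (multiContourSum B k x) w‖ :=
        ContinuousLinearMap.le_opNorm _ _
    _ = ‖C.U (P.mesh 0) (multiContourSum A k x) - 1‖ * ‖w‖ := by rw [norm_U_apply]
    _ ≤ _ := mul_le_mul_of_nonneg_right (norm_U_multiContour_sub_one_le C A k hk hs hA x) (norm_nonneg _)

/-- **`‖(F_{2,k}(A,B)φ)(y)‖ ≤ |e|·s·ε·d(L^k−1) · L^{−kd}Σ_{x∈B^k(y)}‖φ(x)‖`** for `sup_b|A_b| ≤ s`, `k ≤ K`. [cite: Balaban1982Higgs1, (3.15) p.614] -/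
theorem norm_fTwo_apply_le (hk : k ≤ P.K) {s : ℝ} (hs : 0 ≤ s) (hA : ∀ b : PBond P 0, |A b| ≤ s)
    (φ : ScalarField P 0 N) (y : Site P k) :
    ‖fTwo C A B k φ y‖ ≤ |C.e| * s * P.mesh 0 * (P.d * ((P.L : ℝ) ^ k - 1)) *
      ((((P.L : ℝ) ^ (k * P.d))⁻¹) * ∑ x ∈ blockK k y, ‖φ x‖) := by
  set c : ℝ := |C.e| * s * P.mesh 0 * (P.d * ((P.L : ℝ) ^ k - 1)) with hc
  have hLpos : (0 : ℝ) < ((P.L : ℝ) ^ (k * P.d))⁻¹ := inv_pos.mpr (pow_pos (by exact_mod_cast P.hL) _)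
  rw [fTwo_apply, norm_smul, Real.norm_eq_abs, abs_of_pos hLpos, mul_left_comm, Finset.mul_sum]
  refine mul_le_mul_of_nonneg_left ((norm_sum_le _ _).trans (Finset.sum_le_sum fun x _ => ?_)) hLpos.le
  exact norm_fTwo_term_le C A B k hk hs hA x (φ x)

/-- The adjoint twin pointwise: `(F_{2,k}^*ψ)(x) = U((A+B)(Γ))^*ψ(x_k) − U(B(Γ))^*ψ(x_k)`, `x_k` the block point of `x`.
[cite: Balaban1982Higgs1, (3.16) p.615] -/
theorem fTwoAdj_apply (ψ : ScalarField P k N) (x : Site P 0) :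
    fTwoAdj C A B k ψ x = C.U (P.mesh 0) (-multiContourSum B k x)
        (C.U (P.mesh 0) (-multiContourSum A k x) (ψ (blockIter k x)) - ψ (blockIter k x)) := by
  have hadj : ∀ X : VecField P 0,
      avgQkAdj C X k ψ x = star (C.U (P.mesh 0) (multiContourSum X k x)) (ψ (blockIter k x)) := by
    intro X; simp [avgQkAdj]
  rw [fTwoAdj, LinearMap.sub_apply, Pi.sub_apply, hadj, hadj, multiContourSum_add, ChargeData.U_add, star_mul,
    mul_apply_eq_comp, ChargeData.star_U, ChargeData.star_U, map_sub]

/-- **`‖(F_{2,k}(A,B)^*ψ)(x)‖ ≤ |e|·s·ε·d(L^k−1)·‖ψ(x_k)‖`** for `sup_b|A_b| ≤ s`, `k ≤ K`. [cite: Balaban1982Higgs1, (3.16) p.615] -/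
theorem norm_fTwoAdj_apply_le (hk : k ≤ P.K) {s : ℝ} (hs : 0 ≤ s) (hA : ∀ b : PBond P 0, |A b| ≤ s)
    (ψ : ScalarField P k N) (x : Site P 0) :
    ‖fTwoAdj C A B k ψ x‖ ≤ |C.e| * s * P.mesh 0 * (P.d * ((P.L : ℝ) ^ k - 1)) * ‖ψ (blockIter k x)‖ := by
  rw [fTwoAdj_apply, norm_U_apply]
  have e : C.U (P.mesh 0) (-multiContourSum A k x) (ψ (blockIter k x)) - ψ (blockIter k x)
      = (C.U (P.mesh 0) (-multiContourSum A k x) - 1) (ψ (blockIter k x)) := by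
    rw [sub_apply, one_apply_eq_self]
  rw [e]
  have hneg : ‖C.U (P.mesh 0) (-multiContourSum A k x) - 1‖ ≤ |C.e| * s * P.mesh 0 * (P.d * ((P.L : ℝ) ^ k - 1)) := by
    have h := norm_U_multiContour_sub_one_le C A k hk hs hA x
    -- `U(−a) − 1 = U(−a)(1 − U(a))` and `‖U(−a)‖ ≤ 1`
    have hfac : C.U (P.mesh 0) (-multiContourSum A k x) - 1
        = C.U (P.mesh 0) (-multiContourSum A k x) * (1 - C.U (P.mesh 0) (multiContourSum A k x)) := by
      rw [mul_sub, mul_one, U_comm, ChargeData.U_mul_U_neg]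
    rw [hfac]
    calc ‖C.U (P.mesh 0) (-multiContourSum A k x) * (1 - C.U (P.mesh 0) (multiContourSum A k x))‖
        ≤ ‖C.U (P.mesh 0) (-multiContourSum A k x)‖ * ‖1 - C.U (P.mesh 0) (multiContourSum A k x)‖ := norm_mul_le _ _
      _ ≤ 1 * ‖C.U (P.mesh 0) (multiContourSum A k x) - 1‖ :=
          mul_le_mul (opNorm_U_le_one C _ _) (by rw [norm_sub_rev]) (norm_nonneg _) zero_le_one
      _ ≤ _ := by rw [one_mul]; exact h
  calc ‖(C.U (P.mesh 0) (-multiContourSum A k x) - 1) (ψ (blockIter k x))‖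
      ≤ ‖C.U (P.mesh 0) (-multiContourSum A k x) - 1‖ * ‖ψ (blockIter k x)‖ := ContinuousLinearMap.le_opNorm _ _
    _ ≤ _ := mul_le_mul_of_nonneg_right hneg (norm_nonneg _)

/-- **`ℓ²` SIZE OF `F_{2,k}`**: `‖F_{2,k}(A,B)φ‖²_{T^{(k)}} ≤ (|e|·s·ε·d(L^k−1))² ‖φ‖²_{T_ε}` for the scalar products (I.1.5)
(weights `(L^kε)^d` and `ε^d`; Cauchy–Schwarz over each block, `|B^k(y)| = L^{kd}`, `B1Eq353SupNorm.card_blockK`). [cite: Balaban1982Higgs1, (3.15) p.614] -/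
theorem siteInner_fTwo_self_le (hk : k ≤ P.K) {s : ℝ} (hs : 0 ≤ s) (hA : ∀ b : PBond P 0, |A b| ≤ s)
    (φ : ScalarField P 0 N) :
    siteInner (fTwo C A B k φ) (fTwo C A B k φ)
      ≤ (|C.e| * s * P.mesh 0 * (P.d * ((P.L : ℝ) ^ k - 1))) ^ 2 * siteInner φ φ := by
  set c : ℝ := |C.e| * s * P.mesh 0 * (P.d * ((P.L : ℝ) ^ k - 1)) with hc
  have hL : (0 : ℝ) < (P.L : ℝ) ^ (k * P.d) := pow_pos (by exact_mod_cast P.hL) _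
  have hcard : ∀ y : Site P k, ((blockK k y).card : ℝ) = (P.L : ℝ) ^ (k * P.d) := by
    intro y; rw [B1Eq353SupNorm.card_blockK hk y]; push_cast; ring
  -- pointwise: ‖(F₂φ)(y)‖² ≤ c² · L^{-kd} Σ_{x∈B^k(y)} ‖φ x‖²  (Cauchy–Schwarz)
  have hpt : ∀ y : Site P k, ‖fTwo C A B k φ y‖ ^ 2
      ≤ c ^ 2 * ((((P.L : ℝ) ^ (k * P.d))⁻¹) * ∑ x ∈ blockK k y, ‖φ x‖ ^ 2) := by
    intro y
    have h1 := norm_fTwo_apply_le C A B k hk hs hA φ y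
    have hCS : (∑ x ∈ blockK k y, ‖φ x‖) ^ 2 ≤ (blockK k y).card * ∑ x ∈ blockK k y, ‖φ x‖ ^ 2 := by
      have h := Finset.sum_mul_sq_le_sq_mul_sq (blockK k y) (fun _ => (1 : ℝ)) (fun x => ‖φ x‖)
      simpa [Finset.sum_const, nsmul_eq_mul] using h
    calc ‖fTwo C A B k φ y‖ ^ 2 ≤ (c * ((((P.L : ℝ) ^ (k * P.d))⁻¹) * ∑ x ∈ blockK k y, ‖φ x‖)) ^ 2 :=
          pow_le_pow_left₀ (norm_nonneg _) h1 2
      _ = c ^ 2 * ((((P.L : ℝ) ^ (k * P.d))⁻¹) ^ 2 * (∑ x ∈ blockK k y, ‖φ x‖) ^ 2) := by ring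
      _ ≤ c ^ 2 * ((((P.L : ℝ) ^ (k * P.d))⁻¹) ^ 2 * ((blockK k y).card * ∑ x ∈ blockK k y, ‖φ x‖ ^ 2)) := by
          gcongr
      _ = c ^ 2 * ((((P.L : ℝ) ^ (k * P.d))⁻¹) * ∑ x ∈ blockK k y, ‖φ x‖ ^ 2) := by
          rw [hcard]; field_simp
  -- sum over y with the weight (L^kε)^d = L^{kd} ε^d, fibrewise
  have hw : P.mesh k ^ P.d * ((P.L : ℝ) ^ (k * P.d))⁻¹ = P.mesh 0 ^ P.d := by
    unfold Params.mesh
    rw [pow_zero, one_mul, mul_pow, ← pow_mul, mul_assoc, mul_comm (P.ε ^ P.d), ← mul_assoc, mul_inv_cancel₀ hL.ne',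
      one_mul]
  have hfib : ∑ x : Site P 0, P.mesh 0 ^ P.d * ‖φ x‖ ^ 2
      = ∑ y : Site P k, ∑ x ∈ blockK k y, P.mesh 0 ^ P.d * ‖φ x‖ ^ 2 := by
    unfold blockK
    exact (Finset.sum_fiberwise Finset.univ (blockIter k) (fun x => P.mesh 0 ^ P.d * ‖φ x‖ ^ 2)).symm
  rw [siteInner_self_eq, siteInner_self_eq, hfib, Finset.mul_sum]
  refine Finset.sum_le_sum fun y _ => ?_
  calc P.mesh k ^ P.d * ‖fTwo C A B k φ y‖ ^ 2
      ≤ P.mesh k ^ P.d * (c ^ 2 * ((((P.L : ℝ) ^ (k * P.d))⁻¹) * ∑ x ∈ blockK k y, ‖φ x‖ ^ 2)) :=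
        mul_le_mul_of_nonneg_left (hpt y) (pow_nonneg (P.mesh_pos k).le _)
    _ = c ^ 2 * ∑ x ∈ blockK k y, P.mesh 0 ^ P.d * ‖φ x‖ ^ 2 := by
        rw [← hw, Finset.mul_sum, Finset.mul_sum]
        ring_nf
        rw [Finset.mul_sum, Finset.mul_sum]
        refine Finset.sum_congr rfl fun x _ => ?_
        ring

/-- **`ℓ²` SIZE OF THE ADJOINT TWIN**: `‖F_{2,k}(A,B)^*ψ‖²_{T_ε} ≤ (|e|·s·ε·d(L^k−1))² ‖ψ‖²_{T^{(k)}}` (fibrewise over the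
blocks: `|B^k(y)|·ε^d = (L^kε)^d`). [cite: Balaban1982Higgs1, (3.16) p.615] -/
theorem siteInner_fTwoAdj_self_le (hk : k ≤ P.K) {s : ℝ} (hs : 0 ≤ s) (hA : ∀ b : PBond P 0, |A b| ≤ s)
    (ψ : ScalarField P k N) :
    siteInner (fTwoAdj C A B k ψ) (fTwoAdj C A B k ψ)
      ≤ (|C.e| * s * P.mesh 0 * (P.d * ((P.L : ℝ) ^ k - 1))) ^ 2 * siteInner ψ ψ := by
  set c : ℝ := |C.e| * s * P.mesh 0 * (P.d * ((P.L : ℝ) ^ k - 1)) with hc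
  have hL : (0 : ℝ) < (P.L : ℝ) ^ (k * P.d) := pow_pos (by exact_mod_cast P.hL) _
  have hcard : ∀ y : Site P k, ((blockK k y).card : ℝ) = (P.L : ℝ) ^ (k * P.d) := by
    intro y; rw [B1Eq353SupNorm.card_blockK hk y]; push_cast; ring
  have hw : P.mesh k ^ P.d = P.mesh 0 ^ P.d * (P.L : ℝ) ^ (k * P.d) := by
    unfold Params.mesh
    rw [pow_zero, one_mul, mul_pow, ← pow_mul, mul_comm]
  have hε : 0 ≤ P.mesh 0 ^ P.d := pow_nonneg (P.mesh_pos 0).le _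
  rw [siteInner_self_eq, siteInner_self_eq]
  -- pointwise bound, then fibrewise regrouping
  have h1 : ∑ x : Site P 0, P.mesh 0 ^ P.d * ‖fTwoAdj C A B k ψ x‖ ^ 2
      ≤ ∑ x : Site P 0, P.mesh 0 ^ P.d * (c ^ 2 * ‖ψ (blockIter k x)‖ ^ 2) := by
    refine Finset.sum_le_sum fun x _ => mul_le_mul_of_nonneg_left ?_ hε
    rw [← mul_pow]
    exact pow_le_pow_left₀ (norm_nonneg _) (norm_fTwoAdj_apply_le C A B k hk hs hA ψ x) 2
  refine h1.trans (le_of_eq ?_)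
  have hfib : ∑ x : Site P 0, P.mesh 0 ^ P.d * (c ^ 2 * ‖ψ (blockIter k x)‖ ^ 2)
      = ∑ y : Site P k, ∑ x ∈ blockK k y, P.mesh 0 ^ P.d * (c ^ 2 * ‖ψ (blockIter k x)‖ ^ 2) := by
    unfold blockK
    exact (Finset.sum_fiberwise Finset.univ (blockIter k) (fun x => P.mesh 0 ^ P.d * (c ^ 2 * ‖ψ (blockIter k x)‖ ^ 2))).symm
  rw [hfib, Finset.mul_sum]
  refine Finset.sum_congr rfl fun y _ => ?_
  have hconst : ∑ x ∈ blockK k y, P.mesh 0 ^ P.d * (c ^ 2 * ‖ψ (blockIter k x)‖ ^ 2)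
      = ∑ x ∈ blockK k y, P.mesh 0 ^ P.d * (c ^ 2 * ‖ψ y‖ ^ 2) :=
    Finset.sum_congr rfl fun x hx => by rw [(mem_blockK k y x).mp hx]
  rw [hconst, Finset.sum_const, nsmul_eq_mul, hcard, hw]
  ring

end Averaging

/-! ## §3. The weak form of `V_k(A,B)` — (I.3.16) for the scalar products (I.1.5) -/

section WeakForm

variable (C : ChargeData N) (Ω : Finset (Site P 0)) (A B : VecField P 0) (msq a : ℝ) (k : ℕ)

/-- The Laplacian part:
`⟨ψ, (−Δ^{ε,N}_{A+B,Ω})φ⟩ − ⟨ψ, (−Δ^{ε,N}_{B,Ω})φ⟩ = Σ_{b⊂Ω} ε^d[⟪M_bψ(b₊), (D^ε_Bφ)(b)⟫ + ⟪(D^ε_Bψ)(b), M_bφ(b₊)⟫ + ⟪M_bψ(b₊), M_bφ(b₊)⟫]`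
(`HiggsCovariancePos.siteInner_covLaplacianN` + the split `D_{A+B} = D_B + M`). [cite: Balaban1982Higgs1, (3.16) p.615] -/
theorem siteInner_covLaplacianN_add_sub (ψ φ : ScalarField P 0 N) :
    siteInner ψ (covLaplacianN C Ω (A + B) φ) - siteInner ψ (covLaplacianN C Ω B φ)
      = ∑ b : PBond P 0, if Inside Ω b then P.mesh 0 ^ P.d *
          (⟪mulM C A B b (ψ b.tgt), covDeriv C B φ b⟫_ℝ + ⟪covDeriv C B ψ b, mulM C A B b (φ b.tgt)⟫_ℝ
            + ⟪mulM C A B b (ψ b.tgt), mulM C A B b (φ b.tgt)⟫_ℝ) else 0 := by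
  rw [siteInner_covLaplacianN, siteInner_covLaplacianN, ← Finset.sum_sub_distrib]
  refine Finset.sum_congr rfl fun b _ => ?_
  split_ifs with hb
  · rw [covDeriv_add_split, covDeriv_add_split, ← mul_sub]
    congr 1
    simp only [inner_add_left, inner_add_right]
    ring
  · simp

/-- The averaging part: `⟨ψ, P_k(A+B)φ⟩ − ⟨ψ, P_k(B)φ⟩ = ⟨F₂ψ, Q_k(B)φ⟩_{T^{(k)}} + ⟨Q_k(B)ψ, F₂φ⟩_{T^{(k)}} + ⟨F₂ψ, F₂φ⟩_{T^{(k)}}`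
(`P_k = Q_k^*Q_k` with `Q_k^*` the adjoint, `HiggsCovariancePos.siteInner_avgQkLin`; `Q_k(A+B) = Q_k(B) + F₂`). [cite: Balaban1982Higgs1, (3.16) p.615] -/
theorem siteInner_projPk_add_sub (ψ φ : ScalarField P 0 N) :
    siteInner ψ (projPk C (A + B) k φ) - siteInner ψ (projPk C B k φ)
      = siteInner (fTwo C A B k ψ) (avgQkLin C B k φ) + siteInner (avgQkLin C B k ψ) (fTwo C A B k φ)
          + siteInner (fTwo C A B k ψ) (fTwo C A B k φ) := by
  have hP : ∀ X : VecField P 0, siteInner ψ (projPk C X k φ) = siteInner (avgQkLin C X k ψ) (avgQkLin C X k φ) := by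
    intro X
    rw [projPk, LinearMap.comp_apply, ← siteInner_avgQkLin]
  rw [hP, hP, avgQkLin_add]
  simp only [LinearMap.add_apply, siteInner, Pi.add_apply, inner_add_left, inner_add_right, mul_add,
    Finset.sum_add_distrib]
  ring

/-- **THE WEAK FORM OF `V_k(A,B)`** on the carriers of record (the content of (I.3.16) p. 615 for the scalar products (I.1.5)):
`⟨ψ, V_k(A,B)φ⟩_{T_ε} = −Σ_{b⊂Ω} ε^d[⟪M_bψ(b₊), (D^ε_Bφ)(b)⟫ + ⟪(D^ε_Bψ)(b), M_bφ(b₊)⟫ + ⟪M_bψ(b₊), M_bφ(b₊)⟫]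
− a_k(L^kε)^{−2}[⟨F₂ψ, Q_k(B)φ⟩_{T^{(k)}} + ⟨Q_k(B)ψ, F₂φ⟩_{T^{(k)}} + ⟨F₂ψ, F₂φ⟩_{T^{(k)}}]`, `V_k = B3Eq116TwoSidedExpansion.opV` =
`H_k(Ω,B) − H_k(Ω,A+B)` (the mass terms cancel). [cite: Balaban1982Higgs1, (3.16) p.615] -/
theorem siteInner_opV (ψ φ : ScalarField P 0 N) :
    siteInner ψ (opV C Ω A B msq a k φ)
      = -(∑ b : PBond P 0, if Inside Ω b then P.mesh 0 ^ P.d *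
            (⟪mulM C A B b (ψ b.tgt), covDeriv C B φ b⟫_ℝ + ⟪covDeriv C B ψ b, mulM C A B b (φ b.tgt)⟫_ℝ
              + ⟪mulM C A B b (ψ b.tgt), mulM C A B b (φ b.tgt)⟫_ℝ) else 0)
        - (B1.aSeq a P.L k * ((P.mesh k)⁻¹ ^ 2)) *
            (siteInner (fTwo C A B k ψ) (avgQkLin C B k φ) + siteInner (avgQkLin C B k ψ) (fTwo C A B k φ)
              + siteInner (fTwo C A B k ψ) (fTwo C A B k φ)) := by
  rw [← siteInner_covLaplacianN_add_sub, ← siteInner_projPk_add_sub]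
  have hr : ∀ (f : ScalarField P 0 N) g h, siteInner f (g - h) = siteInner f g - siteInner f h := fun f g h => by
    simp only [siteInner, Pi.sub_apply, inner_sub_right, mul_sub, Finset.sum_sub_distrib]
  have ha : ∀ (f : ScalarField P 0 N) g h, siteInner f (g + h) = siteInner f g + siteInner f h := fun f g h => by
    simp only [siteInner, Pi.add_apply, inner_add_right, mul_add, Finset.sum_add_distrib]
  have hs : ∀ (c : ℝ) (f : ScalarField P 0 N) g, siteInner f (c • g) = c * siteInner f g := fun c f g => by
    simp only [siteInner, Pi.smul_apply, inner_smul_right, Finset.mul_sum]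
    exact Finset.sum_congr rfl fun x _ => by ring
  simp only [opV, covOpK, LinearMap.sub_apply, LinearMap.add_apply, LinearMap.smul_apply, LinearMap.id_apply, hr, ha, hs]
  ring

/-- **THE PRINTED BRACKET, WEAK FORM** — `V_k` IS the square bracket of (I.3.44) on these carriers: with `Fm_b = F_{1,k}(−A_b)`,
`⟨ψ, V_k(A,B)φ⟩_{T_ε} = Σ_{b⊂Ω} ε^d[⟪Fm_bψ(b₋), (D^ε_Bφ)(b)⟫ + ⟪(D^ε_Bψ)(b), Fm_bφ(b₋)⟫ − ⟪Fm_bψ(b₋), Fm_bφ(b₋)⟫]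
− a_k(L^kε)^{−2}[⟨F₂ψ, Q_k(B)φ⟩ + ⟨Q_k(B)ψ, F₂φ⟩ + ⟨F₂ψ, F₂φ⟩]` = the form of
`F_{1,k}(−A)^*D^η_B + D^{η*}_BF_{1,k}(−A) − F_{1,k}(−A)^*F_{1,k}(−A) − a_k(F₂^*Q_k(B) + Q_k^*(B)F₂ + F₂^*F₂)` ((I.3.16), mass and
`a_kP_k(B)` terms cancelled against `H_k(Ω,B)`; here `a_k` carries the factor `(L^kε)^{−2}` of the unrescaled (I.2.20)). [cite: Balaban1982Higgs1, (3.44) p.619] -/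
theorem siteInner_opV_printed (ψ φ : ScalarField P 0 N) :
    siteInner ψ (opV C Ω A B msq a k φ)
      = (∑ b : PBond P 0, if Inside Ω b then P.mesh 0 ^ P.d *
            (⟪fOne C (P.mesh 0) (-A b) (ψ b.src), covDeriv C B φ b⟫_ℝ
              + ⟪covDeriv C B ψ b, fOne C (P.mesh 0) (-A b) (φ b.src)⟫_ℝ
              - ⟪fOne C (P.mesh 0) (-A b) (ψ b.src), fOne C (P.mesh 0) (-A b) (φ b.src)⟫_ℝ) else 0)
        - (B1.aSeq a P.L k * ((P.mesh k)⁻¹ ^ 2)) *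
            (siteInner (fTwo C A B k ψ) (avgQkLin C B k φ) + siteInner (avgQkLin C B k ψ) (fTwo C A B k φ)
              + siteInner (fTwo C A B k ψ) (fTwo C A B k φ)) := by
  rw [siteInner_opV, ← Finset.sum_neg_distrib]
  congr 1
  refine Finset.sum_congr rfl fun b _ => ?_
  split_ifs with hb
  · rw [← mul_neg]
    congr 1
    -- both bracketed sums are ±(⟪D_{A+B}ψ, D_{A+B}φ⟫ − ⟪D_Bψ, D_Bφ⟫)
    have e1 : ⟪mulM C A B b (ψ b.tgt), covDeriv C B φ b⟫_ℝ + ⟪covDeriv C B ψ b, mulM C A B b (φ b.tgt)⟫_ℝ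
        + ⟪mulM C A B b (ψ b.tgt), mulM C A B b (φ b.tgt)⟫_ℝ
        = ⟪covDeriv C (A + B) ψ b, covDeriv C (A + B) φ b⟫_ℝ - ⟪covDeriv C B ψ b, covDeriv C B φ b⟫_ℝ := by
      rw [covDeriv_add_split, covDeriv_add_split]
      simp only [inner_add_left, inner_add_right]
      ring
    have e2 := bracket_bond_identity C (P.mesh 0) (A b) (covDeriv C B ψ b) (covDeriv C B φ b) (ψ b.src) (φ b.src)
    rw [← covDeriv_add_eq_U_apply_add_fOne, ← covDeriv_add_eq_U_apply_add_fOne] at e2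
    rw [e1, e2]
    ring
  · simp

end WeakForm

/-! ## §4. The `ℓ²` size of the bond part -/

section BondL2

variable (C : ChargeData N) (Ω : Finset (Site P 0)) (A B : VecField P 0)

/-- **`Σ_{b⊂Ω} ε^d ‖M_bψ(b₊)‖² ≤ (|e|s)²·d·‖ψ‖²_{T_ε}`** for `sup_b|A_b| ≤ s` (each site is the endpoint `b₊` of `d` bonds:
translation `x ↦ x + εe_μ` is a bijection of the torus, `HiggsCovariancePos.shiftEquiv`). [cite: Balaban1982Higgs1, (3.16) p.615] -/
theorem sum_inside_norm_mulM_sq_le {s : ℝ} (hA : ∀ b : PBond P 0, |A b| ≤ s) (ψ : ScalarField P 0 N) :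
    (∑ b : PBond P 0, if Inside Ω b then P.mesh 0 ^ P.d * ‖mulM C A B b (ψ b.tgt)‖ ^ 2 else 0)
      ≤ (|C.e| * s) ^ 2 * (P.d * siteInner ψ ψ) := by
  have hε : 0 ≤ P.mesh 0 ^ P.d := pow_nonneg (P.mesh_pos 0).le _
  -- drop the indicator, bound each bond term, then count: Σ_b ‖ψ(b₊)‖² = d · Σ_x ‖ψ x‖²
  have h1 : (∑ b : PBond P 0, if Inside Ω b then P.mesh 0 ^ P.d * ‖mulM C A B b (ψ b.tgt)‖ ^ 2 else 0)
      ≤ ∑ b : PBond P 0, P.mesh 0 ^ P.d * ((|C.e| * s) ^ 2 * ‖ψ b.tgt‖ ^ 2) := by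
    refine Finset.sum_le_sum fun b _ => ?_
    have hb : P.mesh 0 ^ P.d * ‖mulM C A B b (ψ b.tgt)‖ ^ 2 ≤ P.mesh 0 ^ P.d * ((|C.e| * s) ^ 2 * ‖ψ b.tgt‖ ^ 2) := by
      refine mul_le_mul_of_nonneg_left ?_ hε
      rw [← mul_pow]
      exact pow_le_pow_left₀ (norm_nonneg _) (norm_mulM_apply_le C A B (hA b) _) 2
    split_ifs
    · exact hb
    · exact mul_nonneg hε (by positivity)
  refine h1.trans (le_of_eq ?_)
  have hbond : ∑ b : PBond P 0, P.mesh 0 ^ P.d * ‖ψ b.tgt‖ ^ 2 = P.d * siteInner ψ ψ := by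
    rw [siteInner_self_eq,
      show (∑ b : PBond P 0, P.mesh 0 ^ P.d * ‖ψ b.tgt‖ ^ 2)
          = ∑ b : PBond P 0, P.mesh 0 ^ P.d * ‖ψ (b.src.shift b.dir)‖ ^ 2 from rfl,
      ← sum_site_dir (fun x μ => P.mesh 0 ^ P.d * ‖ψ (x.shift μ)‖ ^ 2), Finset.sum_comm]
    have hμ : ∀ μ : Fin P.d, ∑ x : Site P 0, P.mesh 0 ^ P.d * ‖ψ (x.shift μ)‖ ^ 2
        = ∑ x : Site P 0, P.mesh 0 ^ P.d * ‖ψ x‖ ^ 2 :=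
      fun μ => Fintype.sum_equiv (shiftEquiv P 0 μ) _ _ (fun _ => rfl)
    rw [Finset.sum_congr rfl fun μ _ => hμ μ, Finset.sum_const, Finset.card_univ, Fintype.card_fin, nsmul_eq_mul]
  calc ∑ b : PBond P 0, P.mesh 0 ^ P.d * ((|C.e| * s) ^ 2 * ‖ψ b.tgt‖ ^ 2)
      = (|C.e| * s) ^ 2 * ∑ b : PBond P 0, P.mesh 0 ^ P.d * ‖ψ b.tgt‖ ^ 2 := by
        rw [Finset.mul_sum]; exact Finset.sum_congr rfl fun b _ => by ring
    _ = (|C.e| * s) ^ 2 * (P.d * siteInner ψ ψ) := by rw [hbond]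

end BondL2

end Literature.MathematicalPhysics.QuantumFieldTheory.Balaban1983to89.B3Op116Pieces
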